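import Literature.Combinatorics.SimpleGraph.BridgeContractionRank
import HarnessLib

/-!
# Harmonic 1-forms (flows) on a graph, the maps `φ^*`, `φ_*` induced by a harmonic morphism, and
# `ι^* = −1` for the hyperelliptic involution (Baker–Norine 2009, §4.3: Proposition 34, (4.5),
# Corollary 35; Theorem 58 (1) ⇒ (5), (4) ⇔ (5))

Source (held, read at the page; statements VERBATIM). M. Baker, S. Norine, *Harmonic morphisms
and hyperelliptic graphs*, Int. Math. Res. Not. IMRN 2009, no. 15, 2914–2955 [BakerNorine2009]
(held text `paper:arxiv-0707.1309`, chunks p0013–p0014, p0019–p0020). §4.3: «Let `E⃗(G)` denote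
the set of directed edges of `G`. […] Let `A` be an abelian group, and let `C¹(G, A)` denote the
space of 1-cochains on `G` with values in `A`, i.e., functions `ω : E⃗(G) → A` with the property
that `ω(e) = −ω(ē)` for all `e ∈ E⃗(G)`. […] We define the coboundary operator
`δ : C¹(G, A) → C⁰(G, A)` by the formula `δ(ω)(x) := Σ_{e ∈ E⃗(G), t(e) = x} ω(e)`. An `A`-flow (or
simply a flow if `A = ℝ`) on `G` is a 1-cochain `ω ∈ C¹(G, A)` such that `δ(ω) = 0`. We denote by
`H¹(G, A)` the space of `A`-flows on `G`. […] Suppose `φ : G → G′` is a harmonic morphism […]. We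
define the pullback `φ^*ω′ ∈ C¹(G, A)` by `(φ^*ω′)(e) := ω′(φ(e))` if `φ(e) ∈ E⃗(G′)`, `0`
otherwise, and the push-forward (or trace) `φ_*ω ∈ C¹(G′, A)` by
`φ_*ω(e′) := Σ_{e ∈ E⃗(G), φ(e) = e′} ω(e)`. **Proposition 34.** Let `φ : G → G′` be a harmonic
morphism and let `ω ∈ 𝓗¹(G)`, `ω′ ∈ 𝓗¹(G′)` be harmonic 1-forms. Then: (1) `φ^*ω′ ∈ 𝓗¹(G)`.
(2) `φ_*ω ∈ 𝓗¹(G′)`.» «It follows easily from the definitions that `φ_*φ^*(ω′) = deg(φ) ω′` (4.5)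
for all `ω′ ∈ 𝓗¹(G′)` […]. **Corollary 35.** If `φ : G → G′` is a non-constant harmonic morphism,
then `φ^* : 𝓗¹(G′) → 𝓗¹(G)` is injective and `φ_* : 𝓗¹(G) → 𝓗¹(G′)` is surjective. *Proof.* […]
if `φ^*(ω′) = 0`, then `ω′(φ(e)) = 0` for all horizontal edges `e ∈ E(G)`, and since `φ` maps the
set of horizontal edges of `G` surjectively onto `E(G′)`, it follows that `ω′ = 0`.» §5.3,
**Theorem 58** (for a 2-edge-connected `G` of genus `g ≥ 2` and `ι ∈ Aut(G)`, equivalent): «(1) `G`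
is hyperelliptic with hyperelliptic involution `ι`. […] (4) `ι_* : 𝓗¹(G) → 𝓗¹(G)` is
multiplication by `−1`. (5) `ι^* : 𝓗¹(G) → 𝓗¹(G)` is multiplication by `−1`.» Proof of
(1) ⇒ (5): «let `π : G → T` be the corresponding quotient map from `G` to a tree `T`. […] Let
`ω ∈ 𝓗¹(G)`. Since `T` is a tree, we have `𝓗¹(T) = 0`, and therefore `(π_*ω)(e′) = 0`. On the
other hand, by definition we have `(π_*ω)(e′) = ω(e) + ω(ι(e)) = ω(e) + (ι^*ω)(e)`. […] for
`e ∈ E⃗(G)` with `π(e) ∈ V(T)`, we have `ι(e) = ē`, and thus `(ι^*ω)(e) = −ω(e)` for such edges as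
well.» And: «Since `ι` is a harmonic morphism of degree 1 from `G` to itself, `ι_* ∘ ι^*` is the
identity map on […] `𝓗¹(G)`. It follows easily that […] (4) ⇔ (5).»

## What is formalised (simple graphs: a directed edge is an ordered pair of adjacent vertices, so
## a 1-cochain is an antisymmetric `ω : V → V → A` vanishing off the edges; `t(u, x) = x`)

* `IsOneCochain G ω`, `coboundary G ω x = Σ_{u ∼ x} ω u x` (`δ`), `IsGraphFlow G ω` (`H¹(G, A)`),
  closure under `0, +, −, •`; `cochainPullback G φ ω′` (`φ^*`), `cochainPushforward G′ φ ω`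
  (`φ_*`);
* **Proposition 34** `IsGraphFlow.pullback`, `IsGraphFlow.pushforward`; **(4.5)**
  `IsHarmonicMorphism.cochainPushforward_cochainPullback`; **Corollary 35**
  `IsHarmonicMorphism.cochainPullback_injective` (any `A`, the printed direct argument) and
  `IsHarmonicMorphism.cochainPushforward_surjective` (over a field of characteristic `0`, via
  (4.5));
* «`𝓗¹(T) = 0` for a tree»: `IsGraphFlow.eq_zero_of_isAcyclic` (a flow vanishes across every
  bridge);
* **Theorem 58 (1) ⇒ (5)** `IsGraphFlow.apply_involution` (`ω(ι u, ι x) = −ω(u, x)` for every flow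
  and every mixing involution with simple edge orbits and acyclic quotient — the printed proof), its
  tree-involution form `IsGraphFlow.apply_tree_involution`, and **(4) ⇔ (5)**
  `IsInvolutiveAut.pushforward_eq_neg_iff`.
* functoriality («a contravariant (resp. covariant) functor»): `cochainPullback_id`,
  `cochainPushforward_id`, `IsHarmonicMorphism.cochainPullback_comp`,
  `IsHarmonicMorphism.cochainPushforward_comp`.
For the comparison with the tree's orientation-based flow space `Orientation.flowSpace`
(`FlowSpace.lean`, Godsil–Royle §14.2) note that `δ` here is Kirchhoff's law at each vertex; the
implication (5) ⇒ (1) (through Proposition 36) and `dim 𝓗¹(G) = g` are not typed here.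

Definitions with bodies and theorems; no `sorry`; no named facts; no instances.
-/

open Finset SimpleGraph Matrix
open Literature.Combinatorics.SimpleGraph.ChipFiring

namespace Literature.Combinatorics.SimpleGraph.BakerNorine

variable {V : Type*} [Fintype V] (G : SimpleGraph V) [DecidableRel G.Adj]
variable {V' : Type*} [Fintype V'] [DecidableEq V'] (G' : SimpleGraph V') [DecidableRel G'.Adj]
variable {A : Type*} [AddCommGroup A]

/-! ### §1 1-cochains, the coboundary `δ` and flows -/

omit [Fintype V] [DecidableRel G.Adj] in
/-- A **1-cochain** with values in `A`: «functions `ω : E⃗(G) → A` with the property that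
`ω(e) = −ω(ē)`» — for a simple graph, an antisymmetric function of ordered pairs of vertices
vanishing off the edges. [cite: BakerNorine2009, §4.3] -/
structure IsOneCochain (ω : V → V → A) : Prop where
  /-- `ω(ē) = −ω(e)` -/
  antisymm' : ∀ x y, ω y x = -ω x y
  /-- supported on the directed edges -/
  eq_zero_of_not_adj : ∀ ⦃x y⦄, ¬G.Adj x y → ω x y = 0

/-- The **coboundary** `δ(ω)(x) := Σ_{e ∈ E⃗(G), t(e) = x} ω(e)` (the directed edge `(u, x)`
has terminus `x`). [cite: BakerNorine2009, §4.3 (eq. (4.2))] -/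
def coboundary (ω : V → V → A) (x : V) : A := ∑ u ∈ G.neighborFinset x, ω u x

/-- An **`A`-flow** («a 1-cochain `ω ∈ C¹(G, A)` such that `δ(ω) = 0`»; the `A`-flows form
`H¹(G, A)`, the harmonic 1-forms `𝓗¹(G)` when `A = ℝ`). [cite: BakerNorine2009, §4.3] -/
structure IsGraphFlow (ω : V → V → A) : Prop extends IsOneCochain G ω where
  /-- `δ(ω) = 0` -/
  coboundary_eq_zero : ∀ x, coboundary G ω x = 0

/-- Unfolding `coboundary`. [cite: BakerNorine2009, §4.3 (eq. (4.2))] -/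
theorem coboundary_apply (ω : V → V → A) (x : V) :
    coboundary G ω x = ∑ u ∈ G.neighborFinset x, ω u x := rfl

variable {G}

omit [Fintype V] [DecidableRel G.Adj] in
/-- A 1-cochain vanishes on the diagonal (no loops). [cite: BakerNorine2009, §4.3] -/
theorem IsOneCochain.apply_self {ω : V → V → A} (h : IsOneCochain G ω) (x : V) : ω x x = 0 :=
  h.eq_zero_of_not_adj (G.irrefl (v := x))

omit [Fintype V] [DecidableRel G.Adj] in
/-- `0 ∈ C¹(G, A)`. [cite: BakerNorine2009, §4.3] -/
theorem isOneCochain_zero : IsOneCochain G (0 : V → V → A) where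
  antisymm' := fun _ _ => by simp
  eq_zero_of_not_adj := fun _ _ _ => rfl

omit [Fintype V] [DecidableRel G.Adj] in
/-- `C¹(G, A)` is closed under addition.
[cite: BakerNorine2009, §4.3 («the space of 1-cochains»)] -/
theorem IsOneCochain.add {ω₁ ω₂ : V → V → A} (h₁ : IsOneCochain G ω₁) (h₂ : IsOneCochain G ω₂) :
    IsOneCochain G (ω₁ + ω₂) where
  antisymm' := fun x y => by
    simp only [Pi.add_apply, h₁.antisymm' x y, h₂.antisymm' x y, neg_add]
  eq_zero_of_not_adj := fun x y hxy => by
    simp only [Pi.add_apply, h₁.eq_zero_of_not_adj hxy, h₂.eq_zero_of_not_adj hxy, add_zero]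

omit [Fintype V] [DecidableRel G.Adj] in
/-- `C¹(G, A)` is closed under negation. [cite: BakerNorine2009, §4.3] -/
theorem IsOneCochain.neg {ω : V → V → A} (h : IsOneCochain G ω) : IsOneCochain G (-ω) where
  antisymm' := fun x y => by simp only [Pi.neg_apply, h.antisymm' x y]
  eq_zero_of_not_adj := fun x y hxy => by
    simp only [Pi.neg_apply, h.eq_zero_of_not_adj hxy, neg_zero]

omit [Fintype V] [DecidableRel G.Adj] in
/-- `C¹(G, A)` is closed under scalars. [cite: BakerNorine2009, §4.3] -/
theorem IsOneCochain.smul {R : Type*} [Monoid R] [DistribMulAction R A] (c : R) {ω : V → V → A}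
    (h : IsOneCochain G ω) : IsOneCochain G (c • ω) where
  antisymm' := fun x y => by simp only [Pi.smul_apply, h.antisymm' x y, smul_neg]
  eq_zero_of_not_adj := fun x y hxy => by
    simp only [Pi.smul_apply, h.eq_zero_of_not_adj hxy, smul_zero]

/-- `δ` is additive. [cite: BakerNorine2009, §4.3] -/
theorem coboundary_add (ω₁ ω₂ : V → V → A) :
    coboundary G (ω₁ + ω₂) = coboundary G ω₁ + coboundary G ω₂ := by
  funext x
  simp only [coboundary_apply, Pi.add_apply, sum_add_distrib]

/-- `δ(−ω) = −δ(ω)`. [cite: BakerNorine2009, §4.3] -/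
theorem coboundary_neg (ω : V → V → A) : coboundary G (-ω) = -coboundary G ω := by
  funext x
  simp only [coboundary_apply, Pi.neg_apply, sum_neg_distrib]

/-- `δ(c ω) = c δ(ω)`. [cite: BakerNorine2009, §4.3] -/
theorem coboundary_smul {R : Type*} [Monoid R] [DistribMulAction R A] (c : R) (ω : V → V → A) :
    coboundary G (c • ω) = c • coboundary G ω := by
  funext x
  simp only [coboundary_apply, Pi.smul_apply, smul_sum]

/-- `0 ∈ H¹(G, A)`. [cite: BakerNorine2009, §4.3] -/
theorem isGraphFlow_zero : IsGraphFlow G (0 : V → V → A) where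
  toIsOneCochain := isOneCochain_zero
  coboundary_eq_zero := fun x => by simp [coboundary_apply]

/-- `H¹(G, A)` is closed under addition. [cite: BakerNorine2009, §4.3 («the space of `A`-flows»)] -/
theorem IsGraphFlow.add {ω₁ ω₂ : V → V → A} (h₁ : IsGraphFlow G ω₁) (h₂ : IsGraphFlow G ω₂) :
    IsGraphFlow G (ω₁ + ω₂) where
  toIsOneCochain := h₁.toIsOneCochain.add h₂.toIsOneCochain
  coboundary_eq_zero := fun x => by
    rw [coboundary_add, Pi.add_apply, h₁.coboundary_eq_zero, h₂.coboundary_eq_zero, add_zero]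

/-- `H¹(G, A)` is closed under negation. [cite: BakerNorine2009, §4.3] -/
theorem IsGraphFlow.neg {ω : V → V → A} (h : IsGraphFlow G ω) : IsGraphFlow G (-ω) where
  toIsOneCochain := h.toIsOneCochain.neg
  coboundary_eq_zero := fun x => by
    rw [coboundary_neg, Pi.neg_apply, h.coboundary_eq_zero, neg_zero]

/-- `H¹(G, A)` is closed under scalars. [cite: BakerNorine2009, §4.3] -/
theorem IsGraphFlow.smul {R : Type*} [Monoid R] [DistribMulAction R A] (c : R) {ω : V → V → A}
    (h : IsGraphFlow G ω) : IsGraphFlow G (c • ω) where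
  toIsOneCochain := h.toIsOneCochain.smul c
  coboundary_eq_zero := fun x => by
    rw [coboundary_smul, Pi.smul_apply, h.coboundary_eq_zero, smul_zero]

/-- `δ(ω)(x) = Σ_u ω(u, x)` over all vertices (the non-neighbours contribute `0`).
[cite: BakerNorine2009, §4.3 (eq. (4.2))] -/
theorem IsOneCochain.coboundary_eq_sum_univ {ω : V → V → A} (h : IsOneCochain G ω) (x : V) :
    coboundary G ω x = ∑ u, ω u x := by
  rw [coboundary_apply]
  refine sum_subset (subset_univ _) fun u _ hu => h.eq_zero_of_not_adj fun hux => ?_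
  exact hu ((mem_neighborFinset _ _ _).2 hux.symm)

omit [Fintype V] [DecidableRel G.Adj] in
/-- Antisymmetry: the values of a 1-cochain on the ordered pairs of any vertex set sum to zero
(each undirected edge is counted once with each orientation — the cancellation behind «each
vertical edge […] gets counted twice […] once with each orientation»).
[cite: BakerNorine2009, Proposition 34 (proof of (2))] -/
theorem IsOneCochain.sum_sum_eq_zero {ω : V → V → A} (h : IsOneCochain G ω) (S : Finset V) :
    ∑ u ∈ S, ∑ x ∈ S, ω u x = 0 := by
  rw [← sum_product']
  refine sum_involution (fun p _ => (p.2, p.1)) (fun p _ => ?_) (fun p _ hne heq => ?_)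
    (fun p hp => ?_) (fun p _ => rfl)
  · rw [h.antisymm' p.1 p.2, add_neg_cancel]
  · apply hne
    have h1 : p.1 = p.2 := (Prod.ext_iff.1 heq).1.symm
    rw [h1]
    exact h.apply_self p.2
  · rw [mem_product] at hp ⊢
    exact ⟨hp.2, hp.1⟩

/-! ### §2 Pull-back and push-forward of 1-cochains along a vertex map -/

/-- The **pull-back** «`(φ^*ω′)(e) := ω′(φ(e))` if `φ(e) ∈ E⃗(G′)`, `0` otherwise»: on the
directed edge `(u, x)` of `G` the value `ω′(φ u, φ x)` (which is `0` when `φ(u) = φ(x)`).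
[cite: BakerNorine2009, §4.3] -/
def cochainPullback (G : SimpleGraph V) [DecidableRel G.Adj] (φ : V → V') (ω' : V' → V' → A) :
    V → V → A :=
  fun u x => if G.Adj u x then ω' (φ u) (φ x) else 0

/-- The **push-forward** (trace) «`φ_*ω(e′) := Σ_{e ∈ E⃗(G), φ(e) = e′} ω(e)`»: on the directed
edge `(a, b)` of `G′` the sum of `ω(u, x)` over `φ(u) = a`, `φ(x) = b` (non-adjacent pairs
contribute `0`); `0` off the edges of `G′`. [cite: BakerNorine2009, §4.3] -/
def cochainPushforward (G' : SimpleGraph V') [DecidableRel G'.Adj] (φ : V → V') (ω : V → V → A) :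
    V' → V' → A :=
  fun a b => if G'.Adj a b then
    ∑ u ∈ univ.filter (fun u => φ u = a), ∑ x ∈ univ.filter (fun x => φ x = b), ω u x else 0

omit [Fintype V] [Fintype V'] [DecidableEq V'] [DecidableRel G'.Adj] in
/-- Unfolding `cochainPullback`. [cite: BakerNorine2009, §4.3] -/
theorem cochainPullback_apply (φ : V → V') (ω' : V' → V' → A) (u x : V) :
    cochainPullback G φ ω' u x = if G.Adj u x then ω' (φ u) (φ x) else 0 := rfl

omit [DecidableRel G.Adj] [Fintype V'] in
/-- Unfolding `cochainPushforward`. [cite: BakerNorine2009, §4.3] -/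
theorem cochainPushforward_apply (φ : V → V') (ω : V → V → A) (a b : V') :
    cochainPushforward G' φ ω a b = if G'.Adj a b then
      ∑ u ∈ univ.filter (fun u => φ u = a), ∑ x ∈ univ.filter (fun x => φ x = b), ω u x else 0 :=
  rfl

variable {G'}

omit [Fintype V] [Fintype V'] [DecidableEq V'] [DecidableRel G'.Adj] in
/-- `φ^*(c ω′) = c φ^*(ω′)`. [cite: BakerNorine2009, §4.3 («linear transformations»)] -/
theorem cochainPullback_smul {R : Type*} [Monoid R] [DistribMulAction R A] (c : R) (φ : V → V')
    (ω' : V' → V' → A) : cochainPullback G φ (c • ω') = c • cochainPullback G φ ω' := by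
  funext u x
  simp only [cochainPullback_apply, Pi.smul_apply, smul_ite, smul_zero]

omit [DecidableRel G.Adj] [Fintype V'] in
/-- `φ_*(c ω) = c φ_*(ω)`. [cite: BakerNorine2009, §4.3 («linear transformations»)] -/
theorem cochainPushforward_smul {R : Type*} [Monoid R] [DistribMulAction R A] (c : R) (φ : V → V')
    (ω : V → V → A) : cochainPushforward G' φ (c • ω) = c • cochainPushforward G' φ ω := by
  funext a b
  simp only [cochainPushforward_apply, Pi.smul_apply, smul_ite, smul_zero, smul_sum]

omit [Fintype V] [Fintype V'] [DecidableEq V'] [DecidableRel G'.Adj] in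
/-- `φ^*ω′` is a 1-cochain on `G`. [cite: BakerNorine2009, §4.3 («`φ^*ω′ ∈ C¹(G, A)`»)] -/
theorem IsOneCochain.pullback {ω' : V' → V' → A} (h' : IsOneCochain G' ω') (φ : V → V') :
    IsOneCochain G (cochainPullback G φ ω') where
  antisymm' := fun x y => by
    rw [cochainPullback_apply, cochainPullback_apply]
    by_cases hxy : G.Adj x y
    · rw [if_pos hxy.symm, if_pos hxy, h'.antisymm']
    · rw [if_neg (fun h => hxy h.symm), if_neg hxy, neg_zero]
  eq_zero_of_not_adj := fun x y hxy => by rw [cochainPullback_apply, if_neg hxy]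

omit [DecidableRel G.Adj] [Fintype V'] in
/-- `φ_*ω` is a 1-cochain on `G′`. [cite: BakerNorine2009, §4.3 («`φ_*ω ∈ C¹(G′, A)`»)] -/
theorem IsOneCochain.pushforward {ω : V → V → A} (h : IsOneCochain G ω) (φ : V → V') :
    IsOneCochain G' (cochainPushforward G' φ ω) where
  antisymm' := fun a b => by
    rw [cochainPushforward_apply, cochainPushforward_apply]
    by_cases hab : G'.Adj a b
    · rw [if_pos hab.symm, if_pos hab, sum_comm, ← sum_neg_distrib]
      refine sum_congr rfl fun p _ => ?_
      rw [← sum_neg_distrib]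
      exact sum_congr rfl fun q _ => h.antisymm' p q
    · rw [if_neg (fun h => hab h.symm), if_neg hab, neg_zero]
  eq_zero_of_not_adj := fun a b hab => by rw [cochainPushforward_apply, if_neg hab]

/-! ### §3 Proposition 34: harmonic morphisms preserve flows -/

/-- The fibrewise count behind Proposition 34 (1) and Proposition 12:
`Σ_{u ∼ x} f(φ(u)) = v_φ(x) f(φ(x)) + m_φ(x) Σ_{z ∼ φ(x)} f(z)` for `f` with values in any
additive commutative monoid. [cite: BakerNorine2009, Proposition 34 (proof of (1):
«`= m_φ(x) Σ_{e′ ∈ E⃗(G′), t(e′) = φ(x)} ω′(e′)`»)] -/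
theorem IsHarmonicMorphism.sum_neighborFinset_comp_smul {M : Type*} [AddCommMonoid M] {φ : V → V'}
    (hφ : IsHarmonicMorphism G G' φ) (f : V' → M) (x : V) :
    ∑ u ∈ G.neighborFinset x, f (φ u) =
      vertMult G φ x • f (φ x) + horizMult G G' φ x • ∑ z ∈ G'.neighborFinset (φ x), f z := by
  have hmaps : ∀ u ∈ G.neighborFinset x, φ u ∈ insert (φ x) (G'.neighborFinset (φ x)) := by
    intro u hu
    rw [mem_neighborFinset] at hu
    rcases hφ.adj_or_eq hu with h | h
    · exact mem_insert_of_mem ((mem_neighborFinset _ _ _).2 h)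
    · rw [h]
      exact mem_insert_self _ _
  rw [← sum_fiberwise_of_maps_to' hmaps f, sum_insert (G'.notMem_neighborFinset_self (φ x)),
    smul_sum]
  congr 1
  · rw [sum_const, vertMult_apply]
  · refine sum_congr rfl fun z hz => ?_
    rw [sum_const, hφ.horizMult_eq ((mem_neighborFinset _ _ _).1 hz)]

/-- **Proposition 34 (1)**: «`φ^*ω′ ∈ 𝓗¹(G)`» — the pull-back of a flow along a harmonic morphism
is a flow (`δ(φ^*ω′)(x) = m_φ(x) δ(ω′)(φ(x)) = 0`). [cite: BakerNorine2009, Proposition 34 (1)] -/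
theorem IsGraphFlow.pullback {φ : V → V'} (hφ : IsHarmonicMorphism G G' φ) {ω' : V' → V' → A}
    (h' : IsGraphFlow G' ω') : IsGraphFlow G (cochainPullback G φ ω') where
  toIsOneCochain := h'.toIsOneCochain.pullback φ
  coboundary_eq_zero := fun x => by
    have hrw : ∀ u ∈ G.neighborFinset x, cochainPullback G φ ω' u x = ω' (φ u) (φ x) :=
        fun u hu => by
      rw [cochainPullback_apply, if_pos ((mem_neighborFinset _ _ _).1 hu).symm]
    rw [coboundary_apply, sum_congr rfl hrw,
      hφ.sum_neighborFinset_comp_smul (fun a => ω' a (φ x)) x, h'.apply_self, smul_zero, zero_add,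
      ← coboundary_apply, h'.coboundary_eq_zero, smul_zero]

/-- **Proposition 34 (2)**: «`φ_*ω ∈ 𝓗¹(G′)`» — the push-forward of a flow along a harmonic morphism
is a flow (`δ(φ_*ω)(y) = Σ_{φ(x) = y} δ(ω)(x)`, the vertical edges cancelling in pairs).
[cite: BakerNorine2009, Proposition 34 (2)] -/
theorem IsGraphFlow.pushforward {φ : V → V'} (hφ : IsHarmonicMorphism G G' φ) {ω : V → V → A}
    (h : IsGraphFlow G ω) : IsGraphFlow G' (cochainPushforward G' φ ω) where
  toIsOneCochain := h.toIsOneCochain.pushforward φ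
  coboundary_eq_zero := fun b => by
    -- `F a` = the sum of `ω` over the pairs `(u, x)` with `φ u = a`, `φ x = b`
    set F : V' → A := fun a =>
      ∑ u ∈ univ.filter (fun u => φ u = a), ∑ x ∈ univ.filter (fun x => φ x = b), ω u x with hF
    have hFb : F b = 0 := h.toIsOneCochain.sum_sum_eq_zero _
    have hF0 : ∀ a, ¬G'.Adj a b → F a = 0 := by
      intro a hab
      by_cases hab' : a = b
      · rw [hab']
        exact hFb
      · refine sum_eq_zero fun u hu => sum_eq_zero fun x hx => h.eq_zero_of_not_adj fun hux => ?_
        have hu' : φ u = a := (mem_filter.1 hu).2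
        have hx' : φ x = b := (mem_filter.1 hx).2
        rcases hφ.adj_or_eq hux with h1 | h1
        · rw [hu', hx'] at h1
          exact hab h1
        · rw [hu', hx'] at h1
          exact hab' h1
    calc coboundary G' (cochainPushforward G' φ ω) b
        = ∑ a ∈ G'.neighborFinset b, F a := by
          rw [coboundary_apply]
          refine sum_congr rfl fun a ha => ?_
          rw [cochainPushforward_apply, if_pos ((mem_neighborFinset _ _ _).1 ha).symm]
      _ = ∑ a, F a := by
          refine sum_subset (subset_univ _) fun a _ ha => hF0 a fun hab => ha ?_
          exact (mem_neighborFinset _ _ _).2 hab.symm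
      _ = ∑ u, ∑ x ∈ univ.filter (fun x => φ x = b), ω u x :=
          sum_fiberwise univ φ (fun u => ∑ x ∈ univ.filter (fun x => φ x = b), ω u x)
      _ = ∑ x ∈ univ.filter (fun x => φ x = b), ∑ u, ω u x := sum_comm
      _ = ∑ x ∈ univ.filter (fun x => φ x = b), coboundary G ω x :=
          sum_congr rfl fun x _ => (h.toIsOneCochain.coboundary_eq_sum_univ x).symm
      _ = 0 := sum_eq_zero fun x _ => h.coboundary_eq_zero x

/-! ### §4 `φ_* φ^* = deg(φ)` (4.5) and Corollary 35 -/

/-- **(4.5)**: «`φ_*φ^*(ω′) = deg(φ) ω′`» — read on the directed edge `(a, b)` with the degree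
`Σ_{φ(x) = b} m_φ(x)` over `b` (= `deg(φ)` for connected `G′`). [cite: BakerNorine2009, §4.3
(eq. (4.5))] -/
theorem IsHarmonicMorphism.cochainPushforward_cochainPullback {φ : V → V'}
    (hφ : IsHarmonicMorphism G G' φ) {ω' : V' → V' → A} (h' : IsOneCochain G' ω') (a b : V') :
    cochainPushforward G' φ (cochainPullback G φ ω') a b = harmonicDegree G G' φ b • ω' a b := by
  rw [cochainPushforward_apply]
  by_cases hab : G'.Adj a b
  · rw [if_pos hab]
    calc ∑ u ∈ univ.filter (fun u => φ u = a), ∑ x ∈ univ.filter (fun x => φ x = b),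
          cochainPullback G φ ω' u x
        = ∑ u ∈ univ.filter (fun u => φ u = a), ∑ x ∈ univ.filter (fun x => φ x = b),
            (if G.Adj u x then ω' a b else 0) := by
          refine sum_congr rfl fun u hu => sum_congr rfl fun x hx => ?_
          rw [cochainPullback_apply, (mem_filter.1 hu).2, (mem_filter.1 hx).2]
      _ = ∑ x ∈ univ.filter (fun x => φ x = b), ∑ u ∈ univ.filter (fun u => φ u = a),
            (if G.Adj u x then ω' a b else 0) := sum_comm
      _ = ∑ x ∈ univ.filter (fun x => φ x = b), horizMult G G' φ x • ω' a b := by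
          refine sum_congr rfl fun x hx => ?_
          have hxb : φ x = b := (mem_filter.1 hx).2
          rw [← sum_filter, sum_const, hφ.horizMult_eq (y := a) (by rw [hxb]; exact hab.symm)]
          congr 2
          ext u
          simp only [mem_filter, mem_univ, true_and, mem_neighborFinset]
          constructor
          · rintro ⟨h1, h2⟩
            exact ⟨h2.symm, h1⟩
          · rintro ⟨h1, h2⟩
            exact ⟨h2, h1.symm⟩
      _ = harmonicDegree G G' φ b • ω' a b := by rw [harmonicDegree_apply, sum_smul]
  · rw [if_neg hab, h'.eq_zero_of_not_adj hab, smul_zero]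

/-- **Corollary 35 (injectivity of `φ^*`)** for a non-constant harmonic morphism of connected
graphs, by the printed direct argument: «if `φ^*(ω′) = 0`, then `ω′(φ(e)) = 0` for all
horizontal edges […] and since `φ` maps the set of horizontal edges of `G` surjectively onto
`E(G′)`, it follows that `ω′ = 0`.» [cite: BakerNorine2009, Corollary 35] -/
theorem IsHarmonicMorphism.cochainPullback_injective {φ : V → V'} (hφ : IsHarmonicMorphism G G' φ)
    (hG : G.Connected) (hG' : G'.Connected) {x₁ x₂ : V} (hne : φ x₁ ≠ φ x₂)
    {ω' : V' → V' → A} (h' : IsOneCochain G' ω') (h0 : cochainPullback G φ ω' = 0) : ω' = 0 := by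
  funext a b
  by_cases hab : G'.Adj a b
  · have hdeg : harmonicDegree G G' φ b ≠ 0 := fun h =>
      hne ((hφ.harmonicDegree_eq_zero_iff hG hG' b).1 h x₁ x₂)
    rw [harmonicDegree_apply] at hdeg
    obtain ⟨x, hx, hmx⟩ := exists_ne_zero_of_sum_ne_zero hdeg
    have hxb : φ x = b := (mem_filter.1 hx).2
    rw [hφ.horizMult_eq (y := a) (by rw [hxb]; exact hab.symm), Ne, card_eq_zero,
      ← Ne, ← nonempty_iff_ne_empty] at hmx
    obtain ⟨u, hu⟩ := hmx
    rw [mem_filter, mem_neighborFinset] at hu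
    have := congr_fun (congr_fun h0 u) x
    rw [cochainPullback_apply, if_pos hu.1.symm, hu.2, hxb] at this
    exact this
  · exact h'.eq_zero_of_not_adj hab

/-- **Corollary 35 (surjectivity of `φ_*`)** for a non-constant harmonic morphism of connected
graphs, on flows with values in a field of characteristic `0`: `ω′ = φ_*(φ^*(deg(φ)⁻¹ ω′))` by
(4.5) («Both […] follow easily from (4.5)»). [cite: BakerNorine2009, Corollary 35] -/
theorem IsHarmonicMorphism.cochainPushforward_surjective {K : Type*} [Field K] [CharZero K]
    {φ : V → V'} (hφ : IsHarmonicMorphism G G' φ) (hG : G.Connected) (hG' : G'.Connected)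
    {x₁ x₂ : V} (hne : φ x₁ ≠ φ x₂) {ω' : V' → V' → K} (h' : IsGraphFlow G' ω') :
    ∃ ω : V → V → K, IsGraphFlow G ω ∧ cochainPushforward G' φ ω = ω' := by
  have hd0 : (harmonicDegree G G' φ (φ x₁) : K) ≠ 0 := by
    rw [Nat.cast_ne_zero]
    exact fun h => hne ((hφ.harmonicDegree_eq_zero_iff hG hG' (φ x₁)).1 h x₁ x₂)
  refine ⟨cochainPullback G φ ((harmonicDegree G G' φ (φ x₁) : K)⁻¹ • ω'),
    (h'.smul _).pullback hφ, ?_⟩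
  funext a b
  rw [cochainPullback_smul, cochainPushforward_smul, Pi.smul_apply, Pi.smul_apply,
    hφ.cochainPushforward_cochainPullback h'.toIsOneCochain, hφ.harmonicDegree_eq hG' b (φ x₁),
    smul_eq_mul, nsmul_eq_mul, ← mul_assoc, inv_mul_cancel₀ hd0, one_mul]

/-! ### §5 Flows on a tree vanish -/

/-- A flow vanishes across every bridge: summing `δ(ω) = 0` over one side `G₁` of the bridge,
the pairs inside `G₁` cancel and only the bridge remains. [cite: BakerNorine2009, Theorem 58
(proof of (1) ⇒ (5): «Since `T` is a tree, we have `𝓗¹(T) = 0`»)] -/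
theorem IsGraphFlow.apply_eq_zero_of_isBridge {ω : V → V → A} (h : IsGraphFlow G ω) {u v : V}
    (huv : G.Adj u v) (hb : G.IsBridge s(u, v)) : ω u v = 0 := by
  classical
  obtain ⟨S, hu, hv, hS⟩ := exists_bridge_side hb
  have h0 : ∑ x ∈ S, coboundary G ω x = 0 := sum_eq_zero fun x _ => h.coboundary_eq_zero x
  have hsplit : ∀ x ∈ S, coboundary G ω x =
      ∑ y ∈ S, ω y x + ∑ y ∈ (G.neighborFinset x).filter (fun y => y ∉ S), ω y x := by
    intro x _
    rw [coboundary_apply, ← sum_filter_add_sum_filter_not (G.neighborFinset x) (fun y => y ∈ S)]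
    congr 1
    refine sum_subset (fun y hy => (mem_filter.1 hy).2) fun y hyS hy => ?_
    exact h.eq_zero_of_not_adj fun hyx =>
      hy (mem_filter.2 ⟨(mem_neighborFinset _ _ _).2 hyx.symm, hyS⟩)
  rw [sum_congr rfl hsplit, sum_add_distrib, sum_comm, h.toIsOneCochain.sum_sum_eq_zero S,
    zero_add, sum_eq_single_of_mem u hu fun x hx hxu => ?_] at h0
  · have hfilter : (G.neighborFinset u).filter (fun y => y ∉ S) = {v} := by
      ext y
      rw [mem_filter, mem_neighborFinset, mem_singleton]
      constructor
      · rintro ⟨hy, hyS⟩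
        exact (hS u hu y hyS hy).2
      · rintro rfl
        exact ⟨huv, hv⟩
    rw [hfilter, sum_singleton] at h0
    rw [← neg_neg (ω u v), ← h.antisymm' u v, h0, neg_zero]
  · refine sum_eq_zero fun y hy => ?_
    rw [mem_filter, mem_neighborFinset] at hy
    exact absurd (hS x hx y hy.2 hy.1).1 hxu

/-- **«`𝓗¹(T) = 0`» for a tree** (more generally a forest): every edge is a bridge.
[cite: BakerNorine2009, Theorem 58 (proof of (1) ⇒ (5))] -/
theorem IsGraphFlow.eq_zero_of_isAcyclic {ω : V → V → A} (h : IsGraphFlow G ω) (hG : G.IsAcyclic) :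
    ω = 0 := by
  funext u v
  by_cases huv : G.Adj u v
  · exact h.apply_eq_zero_of_isBridge huv
      (isAcyclic_iff_forall_isBridge.1 hG (G.mem_edgeSet.2 huv))
  · exact h.eq_zero_of_not_adj huv

/-! ### §6 Theorem 58: `ι^* = −1` on `𝓗¹(G)` for the hyperelliptic involution -/

omit [DecidableRel G.Adj] in
/-- The trace along an orbit map `π` of a mixing involution `ι` with simple edge orbits, read on
a horizontal edge: «`(π_*ω)(e′) = ω(e) + ω(ι(e))`». [cite: BakerNorine2009, Theorem 58 (proof of
(1) ⇒ (5))] -/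
theorem IsOrbitMap.cochainPushforward_apply_of_adj [DecidableEq V] {W : Type*} [Fintype W]
    [DecidableEq W]
    {ι : V → V} {π : V → W} [DecidableRel (imageGraph π G).Adj] (hπ : IsOrbitMap ι π)
    (hm : IsMixing G ι) (hs : HasSimpleEdgeOrbits G ι) {ω : V → V → A} (h : IsOneCochain G ω)
    {u x : V} (hux : G.Adj u x) (hne : π u ≠ π x) :
    cochainPushforward (imageGraph π G) π ω (π u) (π x) = ω u x + ω (ι u) (ι x) := by
  rw [cochainPushforward_apply, if_pos (imageGraph_adj.2 ⟨hne, u, x, rfl, rfl, hux⟩)]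
  have hfib : ∀ v, univ.filter (fun y => π y = π v) = {v, ι v} := fun v => by
    ext y
    rw [mem_filter, mem_insert, mem_singleton]
    constructor
    · rintro ⟨-, hy⟩
      exact (hπ.apply_eq_iff v y).1 hy.symm
    · rintro (rfl | rfl)
      · exact ⟨mem_univ _, rfl⟩
      · exact ⟨mem_univ _, hπ.apply_ι _⟩
  rw [hfib u, hfib x]
  by_cases hu : ι u = u <;> by_cases hx : ι x = x
  · exact absurd hx (hm hux hu)
  · rw [hu, Finset.insert_eq_of_mem (mem_singleton_self u), sum_singleton, sum_pair (Ne.symm hx)]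
  · rw [hx, Finset.insert_eq_of_mem (mem_singleton_self x), sum_pair (Ne.symm hu), sum_singleton,
      sum_singleton]
  · rw [sum_pair (Ne.symm hu), sum_pair (Ne.symm hx), sum_pair (Ne.symm hx),
      h.eq_zero_of_not_adj (show ¬G.Adj u (ι x) from fun h' => (hs hux h').elim hu hx),
      h.eq_zero_of_not_adj (show ¬G.Adj (ι u) x from fun h' => (hs hux.symm h'.symm).elim hx hu),
      add_zero, zero_add]

/-- **Theorem 58 (1) ⇒ (5)** (the printed proof): for a mixing involution `ι` with simple edge
orbits whose quotient `G/ι` is a tree (a forest suffices), `ι^*ω = −ω` for every flow `ω`: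
horizontal edges because `π_*ω ∈ 𝓗¹(G/ι) = 0` and «`(π_*ω)(e′) = ω(e) + ω(ι(e))`», vertical edges
because «`ι(e) = ē`». [cite: BakerNorine2009, Theorem 58 ((1) ⇒ (5))] -/
theorem IsGraphFlow.apply_involution {ι : V → V} (hι : IsInvolutiveAut G ι) (hm : IsMixing G ι)
    (hs : HasSimpleEdgeOrbits G ι) (hT : (quotientGraph G ι).IsAcyclic) {ω : V → V → A}
    (h : IsGraphFlow G ω) (u x : V) : ω (ι u) (ι x) = -ω u x := by
  classical
  by_cases hux : G.Adj u x
  swap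
  · have hux' : ¬G.Adj (ι u) (ι x) := fun h' => hux (by
      have h'' := hι.map_adj h'
      rwa [hι.apply_apply, hι.apply_apply] at h'')
    rw [h.eq_zero_of_not_adj hux, h.eq_zero_of_not_adj hux', neg_zero]
  have hπ : IsOrbitMap ι (Quotient.mk (orbitRel ι)) := isOrbitMap_quotientMk hι.involutive
  by_cases hvert : Quotient.mk (orbitRel ι) u = Quotient.mk (orbitRel ι) x
  · -- a vertical edge: `x = ι u`, `ι(e) = ē`
    rcases (hπ.apply_eq_iff u x).1 hvert with hxu | hxu
    · rw [hxu] at hux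
      exact absurd hux (G.irrefl (v := u))
    · rw [hxu, hι.apply_apply]
      exact h.antisymm' u (ι u)
  · -- a horizontal edge: `π_*ω = 0` on the forest `G/ι`
    letI : Fintype (Quotient (orbitRel ι)) := Fintype.ofFinite _
    have hharm : IsHarmonicMorphism G (quotientGraph G ι) (Quotient.mk (orbitRel ι)) :=
      hπ.isHarmonicMorphism hι hm hs
    have h0 := (h.pushforward hharm).eq_zero_of_isAcyclic hT
    have key : cochainPushforward (imageGraph (Quotient.mk (orbitRel ι)) G)
        (Quotient.mk (orbitRel ι)) ω (Quotient.mk (orbitRel ι) u) (Quotient.mk (orbitRel ι) x) =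
        0 :=
      congr_fun (congr_fun h0 _) _
    rw [hπ.cochainPushforward_apply_of_adj hm hs h.toIsOneCochain hux hvert] at key
    exact eq_neg_of_add_eq_zero_right key

/-- **Theorem 58 (1) ⇒ (5)** for the hyperelliptic involution of a 2-edge-connected graph in the
form of Theorem 51 (2) / Corollary 54 (an involutive automorphism `ι` with `G/ι` a tree and simple
edge orbits; mixing is automatic): «`ι^* : 𝓗¹(G) → 𝓗¹(G)` is multiplication by `−1`».
[cite: BakerNorine2009, Theorem 58 ((1) ⇒ (5))] -/
theorem IsGraphFlow.apply_tree_involution [DecidableEq V] (h2 : G.IsEdgeConnected 2) {ι : V → V}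
    (hι : IsInvolutiveAut G ι) (hT : (quotientGraph G ι).IsTree) (hs : HasSimpleEdgeOrbits G ι)
    {ω : V → V → A} (h : IsGraphFlow G ω) (u x : V) : ω (ι u) (ι x) = -ω u x :=
  h.apply_involution hι (isMixing_of_isTree_quotientGraph h2 hι hT) hs hT.isAcyclic u x

omit [Fintype V] in
/-- `ι^*ω` for an automorphism `ι`: `(ι^*ω)(u, x) = ω(ι u, ι x)`. [cite: BakerNorine2009, §4.3
(«an automorphism `α` of a graph `G` induces an automorphism `α^*`»)] -/
theorem IsInvolutiveAut.pullback_apply {ι : V → V} (hι : IsInvolutiveAut G ι)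
    {ω : V → V → A} (h : IsOneCochain G ω) (u x : V) :
    cochainPullback G ι ω u x = ω (ι u) (ι x) := by
  rw [cochainPullback_apply]
  by_cases hux : G.Adj u x
  · rw [if_pos hux]
  · rw [if_neg hux, h.eq_zero_of_not_adj fun h' => hux ?_]
    have h'' := hι.map_adj h'
    rwa [hι.apply_apply, hι.apply_apply] at h''

/-- `ι_*ω` for an involutive automorphism `ι`: `(ι_*ω)(a, b) = ω(ι a, ι b)` (the fibres of `ι`
are the singletons `{ι a}`). [cite: BakerNorine2009, §4.3] -/
theorem IsInvolutiveAut.pushforward_apply [DecidableEq V] {ι : V → V} (hι : IsInvolutiveAut G ι)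
    {ω : V → V → A} (h : IsOneCochain G ω) (a b : V) :
    cochainPushforward G ι ω a b = ω (ι a) (ι b) := by
  have hfib : ∀ v, univ.filter (fun y => ι y = v) = {ι v} := fun v => by
    ext y
    rw [mem_filter, mem_singleton]
    constructor
    · rintro ⟨-, hy⟩
      rw [← hy, hι.apply_apply]
    · rintro rfl
      exact ⟨mem_univ _, hι.apply_apply v⟩
  rw [cochainPushforward_apply, hfib a, hfib b, sum_singleton, sum_singleton]
  by_cases hab : G.Adj a b
  · rw [if_pos hab]
  · rw [if_neg hab, h.eq_zero_of_not_adj fun h' => hab ?_]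
    have h'' := hι.map_adj h'
    rwa [hι.apply_apply, hι.apply_apply] at h''

/-- **Theorem 58 (4) ⇔ (5)** for an involutive automorphism: `ι_* = −1` on the 1-cochains iff
`ι^* = −1` («`ι_* ∘ ι^*` is the identity map […] It follows easily that (4) ⇔ (5)»; here both
read `ω(ι u, ι x) = −ω(u, x)`). [cite: BakerNorine2009, Theorem 58 ((4) ⇔ (5))] -/
theorem IsInvolutiveAut.pushforward_eq_neg_iff [DecidableEq V] {ι : V → V}
    (hι : IsInvolutiveAut G ι)
    {ω : V → V → A} (h : IsOneCochain G ω) :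
    cochainPushforward G ι ω = -ω ↔ cochainPullback G ι ω = -ω := by
  have key : cochainPushforward G ι ω = cochainPullback G ι ω := by
    funext a b
    rw [hι.pushforward_apply h, hι.pullback_apply h]
  rw [key]

/-! ### §7 Functoriality of `φ^*` and `φ_*` -/

section Functorial

variable {V'' : Type*} [Fintype V''] [DecidableEq V''] {G'' : SimpleGraph V''}
  [DecidableRel G''.Adj]

omit [Fintype V] in
/-- `id^* ω = ω` for a 1-cochain. [cite: BakerNorine2009, §4.3 («a contravariant […] functor»)] -/
theorem IsOneCochain.cochainPullback_id {ω : V → V → A} (h : IsOneCochain G ω) :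
    cochainPullback G id ω = ω := by
  funext u x
  rw [cochainPullback_apply]
  by_cases hux : G.Adj u x
  · rw [if_pos hux, id, id]
  · rw [if_neg hux, h.eq_zero_of_not_adj hux]

/-- `id_* ω = ω` for a 1-cochain. [cite: BakerNorine2009, §4.3 («a covariant […] functor»)] -/
theorem IsOneCochain.cochainPushforward_id [DecidableEq V] {ω : V → V → A} (h : IsOneCochain G ω) :
    cochainPushforward G id ω = ω := by
  funext a b
  have hfib : ∀ v : V, univ.filter (fun y => id y = v) = {v} := fun v => by
    ext y
    rw [mem_filter, mem_singleton, id]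
    exact ⟨fun h => h.2, fun h => ⟨mem_univ _, h⟩⟩
  rw [cochainPushforward_apply, hfib a, hfib b, sum_singleton, sum_singleton]
  by_cases hab : G.Adj a b
  · rw [if_pos hab]
  · rw [if_neg hab, h.eq_zero_of_not_adj hab]

omit [Fintype V'] [Fintype V''] [DecidableEq V''] [DecidableRel G''.Adj] in
/-- **`(ψ ∘ φ)^* = φ^* ∘ ψ^*`** on 1-cochains, for a harmonic (indeed any) morphism `φ` («the
association `(G′, φ) ↦ (𝓗¹(G′), φ^*)` […] is a contravariant functor»).
[cite: BakerNorine2009, §4.3] -/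
theorem IsHarmonicMorphism.cochainPullback_comp {φ : V → V'} {ψ : V' → V''}
    (hφ : IsHarmonicMorphism G G' φ) {ω'' : V'' → V'' → A} (h'' : IsOneCochain G'' ω'') :
    cochainPullback G (ψ ∘ φ) ω'' = cochainPullback G φ (cochainPullback G' ψ ω'') := by
  funext u x
  simp only [cochainPullback_apply, Function.comp_apply]
  by_cases hux : G.Adj u x
  · rw [if_pos hux, if_pos hux]
    rcases hφ.adj_or_eq hux with h | h
    · rw [if_pos h]
    · rw [h, if_neg (G'.irrefl (v := φ x))]
      exact h''.apply_self _
  · rw [if_neg hux, if_neg hux]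

omit [Fintype V''] in
/-- Collapsing a double fibre sum: `Σ_{ψ(a) = c} Σ_{φ(u) = a} F(u) = Σ_{ψ(φ(u)) = c} F(u)`.
[cite: BakerNorine2009, §4.3 («a covariant […] functor»)] -/
private theorem sum_fiber_fiber {M : Type*} [AddCommMonoid M] (φ : V → V') (ψ : V' → V'') (c : V'')
    (F : V → M) :
    ∑ a ∈ univ.filter (fun a => ψ a = c), ∑ u ∈ univ.filter (fun u => φ u = a), F u =
      ∑ u ∈ univ.filter (fun u => ψ (φ u) = c), F u := by
  have hmaps : ∀ u ∈ univ.filter (fun u => ψ (φ u) = c), φ u ∈ univ.filter (fun a => ψ a = c) :=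
    fun u hu => mem_filter.2 ⟨mem_univ _, (mem_filter.1 hu).2⟩
  rw [← sum_fiberwise_of_maps_to hmaps F]
  refine sum_congr rfl fun a ha => sum_congr ?_ fun _ _ => rfl
  ext u
  simp only [mem_filter, mem_univ, true_and]
  constructor
  · intro h
    refine ⟨?_, h⟩
    rw [h]
    exact (mem_filter.1 ha).2
  · rintro ⟨-, h⟩
    exact h

omit [Fintype V''] in
/-- **`(ψ ∘ φ)_* = ψ_* ∘ φ_*`** on 1-cochains, for a morphism `φ` and `G″`-edges read through
`ψ` («the association `(G, φ) ↦ (𝓗¹(G′), φ_*)` is a covariant functor»).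
[cite: BakerNorine2009, §4.3] -/
theorem IsHarmonicMorphism.cochainPushforward_comp {φ : V → V'} {ψ : V' → V''}
    (hφ : IsHarmonicMorphism G G' φ) {ω : V → V → A} (h : IsOneCochain G ω) :
    cochainPushforward G'' (ψ ∘ φ) ω = cochainPushforward G'' ψ (cochainPushforward G' φ ω) := by
  funext c d
  rw [cochainPushforward_apply, cochainPushforward_apply]
  by_cases hcd : G''.Adj c d
  · rw [if_pos hcd, if_pos hcd]
    simp only [Function.comp_apply]
    symm
    calc ∑ a ∈ univ.filter (fun a => ψ a = c), ∑ b ∈ univ.filter (fun b => ψ b = d),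
          cochainPushforward G' φ ω a b
        = ∑ a ∈ univ.filter (fun a => ψ a = c), ∑ b ∈ univ.filter (fun b => ψ b = d),
            ∑ u ∈ univ.filter (fun u => φ u = a), ∑ x ∈ univ.filter (fun x => φ x = b), ω u x := by
          refine sum_congr rfl fun a ha => sum_congr rfl fun b hb => ?_
          rw [cochainPushforward_apply]
          by_cases hab : G'.Adj a b
          · rw [if_pos hab]
          · rw [if_neg hab]
            symm
            refine sum_eq_zero fun u hu => sum_eq_zero fun x hx =>
              h.eq_zero_of_not_adj fun hux => ?_
            have hua := (mem_filter.1 hu).2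
            have hxb := (mem_filter.1 hx).2
            rcases hφ.adj_or_eq hux with h1 | h1
            · rw [hua, hxb] at h1
              exact hab h1
            · apply hcd.ne
              rw [← (mem_filter.1 ha).2, ← (mem_filter.1 hb).2, ← hua, ← hxb, h1]
      _ = ∑ a ∈ univ.filter (fun a => ψ a = c), ∑ u ∈ univ.filter (fun u => φ u = a),
            ∑ b ∈ univ.filter (fun b => ψ b = d), ∑ x ∈ univ.filter (fun x => φ x = b), ω u x :=
          sum_congr rfl fun _ _ => sum_comm
      _ = ∑ a ∈ univ.filter (fun a => ψ a = c), ∑ u ∈ univ.filter (fun u => φ u = a),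
            ∑ x ∈ univ.filter (fun x => ψ (φ x) = d), ω u x :=
          sum_congr rfl fun _ _ => sum_congr rfl fun u _ => sum_fiber_fiber φ ψ d (fun x => ω u x)
      _ = ∑ u ∈ univ.filter (fun u => ψ (φ u) = c), ∑ x ∈ univ.filter (fun x => ψ (φ x) = d),
            ω u x := sum_fiber_fiber φ ψ c _
  · rw [if_neg hcd, if_neg hcd]

end Functorial

end Literature.Combinatorics.SimpleGraph.BakerNorine
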